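import Mathlib
import Summits.CriticalPhenomena.Ising3DConformalLimit.Theses.HyperoctahedralRP
import Literature.MathematicalPhysics.QuantumFieldTheory.LatticeMirrorNormals
import Literature.MathematicalPhysics.QuantumFieldTheory.MirrorRPKernel

/-!
# Crux `HyperoctahedralRP.HRP2Rigidity` (stmt-CriticalPhenomena-1979) — negative-side support, II

Standing crux disprover (cdisprove), THEOREM-ONLY (companion of `Negative/LoadBearing.lean`, independent of it):

* `rp_mul` — Schur: the product of two symmetric mirror-RP kernels (crux form = `IsMirrorRPKernel`) is
  mirror-RP (`Matrix.PosSemidef.hadamard`).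
* `hrp2Rigidity_descent` — Δ-MONOTONICITY: if `‖x‖^(-2Δ')` is mirror-RP for the nine normals (Frank–Lieb 2010,
  Lemma 2.1: iff `2Δ' ≥ 1`; a hypothesis here) then the crux body at exponent `Δ + Δ'` implies the crux body
  at exponent `Δ` (a counterexample `K` at `Δ` gives `K·‖x‖^(-2Δ')` at `Δ + Δ'`). Non-rigidity is upward
  closed; inside the window the crux at `Δ = 1` implies the crux at `Δ = 1/2`; `Δ = 1` is the weakest point.
* `leaf_kernel_identity`, `leafPhi_antitone`, `leaf_round_of_Phi_eq` — the real-variable core of the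
  `a = 1` (`Δ = 1/2`) GLOBAL step found by the disprover: along a meridian leaf with (discrete) Stieltjes
  measure `Σ wᵢ δ_{σᵢ}`, `Φ(s) = (1+s) Σ wᵢ (1-σᵢ)/(s+σᵢ)` (`= (1+s)(C(s) - C(pole))`) is non-increasing,
  strictly unless all charged atoms sit at `σ = 1` (round leaf). With it: poles are global maxima of the
  angular profile, circles through two oblique poles are round, and a sweep of `(e₁+e₃)/√2`-leaves across
  `{k₃ = 0}` gives isotropy at `Δ = 1/2` conditional on the LOCAL step (`Disproof.lean` F9–F11).
-/

noncomputable section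

open scoped BigOperators InnerProductSpace Matrix

namespace Summit.CriticalPhenomena.Ising3DConformalLimit.Theorems.HRP2Rigidity.Negative

open Literature.MathematicalPhysics.QuantumFieldTheory

/-! ## Schur product and Δ-monotonicity -/

/-- The crux's double sum is the quadratic form `c ⬝ᵥ (M *ᵥ c)`. -/
theorem quadForm_eq_dotProduct {m : ℕ} (M : Matrix (Fin m) (Fin m) ℝ) (c : Fin m → ℝ) :
    ∑ a, ∑ b, c a * c b * M a b = c ⬝ᵥ (M *ᵥ c) := by
  simp only [dotProduct, Matrix.mulVec, Finset.mul_sum]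
  exact Finset.sum_congr rfl fun a _ => Finset.sum_congr rfl fun b _ => by ring

/-- A symmetric RP Gram family (crux form = `IsMirrorRPKernel`) is a positive semidefinite matrix. -/
theorem posSemidef_of_rp {n : (EuclideanSpace ℝ (Fin 3))} {K : (EuclideanSpace ℝ (Fin 3)) → ℝ} (hK : IsMirrorRPKernel n K)
    (hsymm : ∀ p q : (EuclideanSpace ℝ (Fin 3)), K (p - (ℝ ∙ n)ᗮ.reflection q) = K (q - (ℝ ∙ n)ᗮ.reflection p))
    {m : ℕ} (p : Fin m → (EuclideanSpace ℝ (Fin 3))) (hp : ∀ a, 0 < ⟪p a, n⟫_ℝ) :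
    (Matrix.of fun a b => K (p a - (ℝ ∙ n)ᗮ.reflection (p b))).PosSemidef := by
  refine Matrix.PosSemidef.of_dotProduct_mulVec_nonneg ?_ ?_
  · refine Matrix.IsHermitian.ext fun a b => ?_
    simp only [Matrix.of_apply, star_trivial]
    exact hsymm _ _
  · intro x
    rw [star_trivial, ← quadForm_eq_dotProduct]
    simpa only [Matrix.of_apply] using hK m p x hp

/-- TOOL (Schur product): the pointwise product of two symmetric mirror-RP kernels is mirror-RP. -/
theorem rp_mul {n : (EuclideanSpace ℝ (Fin 3))} {K₁ K₂ : (EuclideanSpace ℝ (Fin 3)) → ℝ} (h₁ : IsMirrorRPKernel n K₁) (h₂ : IsMirrorRPKernel n K₂)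
    (hs₁ : ∀ p q : (EuclideanSpace ℝ (Fin 3)), K₁ (p - (ℝ ∙ n)ᗮ.reflection q) = K₁ (q - (ℝ ∙ n)ᗮ.reflection p))
    (hs₂ : ∀ p q : (EuclideanSpace ℝ (Fin 3)), K₂ (p - (ℝ ∙ n)ᗮ.reflection q) = K₂ (q - (ℝ ∙ n)ᗮ.reflection p)) :
    IsMirrorRPKernel n (fun x => K₁ x * K₂ x) := by
  intro m p c hp
  have hM := (posSemidef_of_rp h₁ hs₁ p hp).hadamard (posSemidef_of_rp h₂ hs₂ p hp)
  have := hM.dotProduct_mulVec_nonneg c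
  rw [star_trivial, ← quadForm_eq_dotProduct] at this
  simpa only [Matrix.hadamard_apply, Matrix.of_apply] using this

/-- **Δ-MONOTONICITY (Schur descent).** If the round kernel `‖x‖^(-2Δ')` is mirror-RP for the nine lattice
normals (Frank–Lieb 2010, Lemma 2.1 / Glimm–Jaffe Prop. 6.2.5: true iff `2Δ' ≥ 1` in `ℝ³`; a HYPOTHESIS
here), then the crux body at exponent `Δ + Δ'` implies the crux body at exponent `Δ`: a counterexample `K`
at `Δ` yields the counterexample `K · ‖x‖^(-2Δ')` at `Δ + Δ'`. Non-rigidity is upward closed under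
`Δ ↦ Δ + Δ'`; in the window, the crux at `Δ = 1` implies the crux at `Δ = 1/2` (take `Δ = Δ' = 1/2`). -/
theorem hrp2Rigidity_descent {Δ Δ' : ℝ}
    (hround : ∀ n : (EuclideanSpace ℝ (Fin 3)), (∃ i j : Fin 3, i ≠ j ∧ (n = EuclideanSpace.single i 1 ∨
      n = EuclideanSpace.single i 1 + EuclideanSpace.single j 1 ∨
      n = EuclideanSpace.single i 1 - EuclideanSpace.single j 1)) →
      IsMirrorRPKernel n (fun x : (EuclideanSpace ℝ (Fin 3)) => ‖x‖ ^ (-(2 * Δ'))))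
    (h : ∀ (K : (EuclideanSpace ℝ (Fin 3)) → ℝ), ContinuousOn K {0}ᶜ → (∀ x, x ≠ 0 → 0 < K x) →
      (∀ c : ℝ, 0 < c → ∀ x, K (c • x) = c ^ (-(2 * (Δ + Δ'))) * K x) →
      (∀ n : (EuclideanSpace ℝ (Fin 3)), (∃ i j : Fin 3, i ≠ j ∧ (n = EuclideanSpace.single i 1 ∨
        n = EuclideanSpace.single i 1 + EuclideanSpace.single j 1 ∨
        n = EuclideanSpace.single i 1 - EuclideanSpace.single j 1)) →
        (∀ x, K (((ℝ ∙ n)ᗮ).reflection x) = K x) ∧ IsMirrorRPKernel n K) →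
      ∀ (R : (EuclideanSpace ℝ (Fin 3)) ≃ₗᵢ[ℝ] (EuclideanSpace ℝ (Fin 3))) (x : (EuclideanSpace ℝ (Fin 3))), K (R x) = K x)
    (K : (EuclideanSpace ℝ (Fin 3)) → ℝ) (hc : ContinuousOn K {0}ᶜ) (hpos : ∀ x, x ≠ 0 → 0 < K x)
    (hhom : ∀ c : ℝ, 0 < c → ∀ x, K (c • x) = c ^ (-(2 * Δ)) * K x)
    (hnine : ∀ n : (EuclideanSpace ℝ (Fin 3)), (∃ i j : Fin 3, i ≠ j ∧ (n = EuclideanSpace.single i 1 ∨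
      n = EuclideanSpace.single i 1 + EuclideanSpace.single j 1 ∨
      n = EuclideanSpace.single i 1 - EuclideanSpace.single j 1)) →
      (∀ x, K (((ℝ ∙ n)ᗮ).reflection x) = K x) ∧ IsMirrorRPKernel n K)
    (R : (EuclideanSpace ℝ (Fin 3)) ≃ₗᵢ[ℝ] (EuclideanSpace ℝ (Fin 3))) (x : (EuclideanSpace ℝ (Fin 3))) : K (R x) = K x := by
  set K' : (EuclideanSpace ℝ (Fin 3)) → ℝ := fun y => K y * ‖y‖ ^ (-(2 * Δ')) with hK'
  have hinv : ∀ n : (EuclideanSpace ℝ (Fin 3)), (∃ i j : Fin 3, i ≠ j ∧ (n = EuclideanSpace.single i 1 ∨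
      n = EuclideanSpace.single i 1 + EuclideanSpace.single j 1 ∨
      n = EuclideanSpace.single i 1 - EuclideanSpace.single j 1)) →
      ∀ y, K (((ℝ ∙ n)ᗮ).reflection y) = K y := fun n hn => (hnine n hn).1
  have heven : ∀ y, K (-y) = K y := by
    intro y
    have hneg : (ℝ ∙ EuclideanSpace.single (0 : Fin 3) (1 : ℝ))ᗮ.reflection
        ((ℝ ∙ EuclideanSpace.single (1 : Fin 3) (1 : ℝ))ᗮ.reflection
          ((ℝ ∙ EuclideanSpace.single (2 : Fin 3) (1 : ℝ))ᗮ.reflection y)) = -y := by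
      ext l
      simp only [reflection_single_apply, PiLp.neg_apply]
      fin_cases l <;> simp
    rw [← hneg, hinv _ ⟨0, 1, by decide, Or.inl rfl⟩, hinv _ ⟨1, 0, by decide, Or.inl rfl⟩,
      hinv _ ⟨2, 0, by decide, Or.inl rfl⟩]
  have hc' : ContinuousOn K' {0}ᶜ := by
    refine hc.mul ?_
    intro y hy
    have hy' : ‖y‖ ≠ 0 := norm_ne_zero_iff.2 hy
    exact (continuous_norm.continuousAt.rpow_const (Or.inl hy')).continuousWithinAt
  have hpos' : ∀ y, y ≠ 0 → 0 < K' y := fun y hy =>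
    mul_pos (hpos y hy) (Real.rpow_pos_of_pos (norm_pos_iff.2 hy) _)
  have hhom' : ∀ c : ℝ, 0 < c → ∀ y, K' (c • y) = c ^ (-(2 * (Δ + Δ'))) * K' y := by
    intro c hcpos y
    simp only [hK']
    rw [hhom c hcpos y, norm_smul, Real.norm_of_nonneg hcpos.le,
      Real.mul_rpow hcpos.le (norm_nonneg _),
      show -(2 * (Δ + Δ')) = -(2 * Δ) + -(2 * Δ') by ring, Real.rpow_add hcpos]
    ring
  have hnine' : ∀ n : (EuclideanSpace ℝ (Fin 3)), (∃ i j : Fin 3, i ≠ j ∧ (n = EuclideanSpace.single i 1 ∨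
      n = EuclideanSpace.single i 1 + EuclideanSpace.single j 1 ∨
      n = EuclideanSpace.single i 1 - EuclideanSpace.single j 1)) →
      (∀ y, K' (((ℝ ∙ n)ᗮ).reflection y) = K' y) ∧ IsMirrorRPKernel n K' := by
    intro n hn
    refine ⟨fun y => by simp only [hK', hinv n hn y, LinearIsometryEquiv.norm_map], ?_⟩
    exact rp_mul (hnine n hn).2 (hround n hn) (mirrorKernel_symm_of_even heven (hinv n hn))
      (mirrorKernel_symm_of_even (K := fun y : (EuclideanSpace ℝ (Fin 3)) => ‖y‖ ^ (-(2 * Δ'))) (n := n)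
        (fun y => by simp [norm_neg]) (fun y => by simp))
  have key := h K' hc' hpos' hhom' hnine' R x
  simp only [hK', LinearIsometryEquiv.norm_map] at key
  by_cases hx : x = 0
  · subst hx; simp
  · have hr : 0 < ‖x‖ ^ (-(2 * Δ')) := Real.rpow_pos_of_pos (norm_pos_iff.2 hx) _
    exact mul_right_cancel₀ hr.ne' key

/-! ## The `a = 1` (Δ = 1/2) leaf monotonicity -/

/-- The pointwise identity behind the `a = 1` leaf monotonicity:
`(1+s)(1-σ)/(s+σ) - (1+t)(1-σ)/(t+σ) = (t-s)(1-σ)²/((s+σ)(t+σ))`. -/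
theorem leaf_kernel_identity {s t σ : ℝ} (hs : s + σ ≠ 0) (ht : t + σ ≠ 0) :
    (1 + s) * ((1 - σ) / (s + σ)) - (1 + t) * ((1 - σ) / (t + σ)) =
      (t - s) * ((1 - σ) ^ 2 / ((s + σ) * (t + σ))) := by
  field_simp
  ring

/-- TOOL (a = 1 leaf monotonicity, discrete form). For a finitely supported positive measure
`Σ wᵢ δ_{σᵢ}` on `(0, ∞)`, `Φ(s) = (1+s) Σ wᵢ (1 - σᵢ)/(s + σᵢ)` — at `a = 1` this is
`(1+s)(C(s) - C(pole))` along a meridian leaf with Stieltjes measure `Σ wᵢ δ_{σᵢ}` — is non-increasing on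
`[0, ∞)`. (Measure version: the same computation under the integral sign.) -/
theorem leafPhi_antitone {ι : Type*} (S : Finset ι) (w σ : ι → ℝ) (hw : ∀ i ∈ S, 0 ≤ w i)
    (hσ : ∀ i ∈ S, 0 < σ i) {s t : ℝ} (hs : 0 ≤ s) (hst : s ≤ t) :
    (1 + t) * ∑ i ∈ S, w i * ((1 - σ i) / (t + σ i)) ≤
      (1 + s) * ∑ i ∈ S, w i * ((1 - σ i) / (s + σ i)) := by
  rw [Finset.mul_sum, Finset.mul_sum, ← sub_nonneg, ← Finset.sum_sub_distrib]
  refine Finset.sum_nonneg fun i hi => ?_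
  have h1 : 0 < s + σ i := by linarith [hσ i hi]
  have h2 : 0 < t + σ i := by linarith [hσ i hi]
  have key : (1 + s) * (w i * ((1 - σ i) / (s + σ i))) - (1 + t) * (w i * ((1 - σ i) / (t + σ i))) =
      w i * ((t - s) * ((1 - σ i) ^ 2 / ((s + σ i) * (t + σ i)))) := by
    rw [← leaf_kernel_identity h1.ne' h2.ne']; ring
  rw [key]
  exact mul_nonneg (hw i hi) (mul_nonneg (by linarith) (div_nonneg (sq_nonneg _) (mul_pos h1 h2).le))

/-- TOOL (a = 1 rigidity of a leaf). If `Φ s = Φ t` for some `0 ≤ s < t` then every atom with positive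
weight sits at `σ = 1`: the leaf is round. -/
theorem leaf_round_of_Phi_eq {ι : Type*} (S : Finset ι) (w σ : ι → ℝ) (hw : ∀ i ∈ S, 0 ≤ w i)
    (hσ : ∀ i ∈ S, 0 < σ i) {s t : ℝ} (hs : 0 ≤ s) (hst : s < t)
    (heq : (1 + t) * ∑ i ∈ S, w i * ((1 - σ i) / (t + σ i)) =
      (1 + s) * ∑ i ∈ S, w i * ((1 - σ i) / (s + σ i))) :
    ∀ i ∈ S, 0 < w i → σ i = 1 := by
  have hterm : ∀ i ∈ S, 0 ≤ w i * ((t - s) * ((1 - σ i) ^ 2 / ((s + σ i) * (t + σ i)))) := by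
    intro i hi
    have h1 : 0 < s + σ i := by linarith [hσ i hi]
    have h2 : 0 < t + σ i := by linarith [hσ i hi]
    exact mul_nonneg (hw i hi) (mul_nonneg (by linarith) (div_nonneg (sq_nonneg _) (mul_pos h1 h2).le))
  have hsum : ∑ i ∈ S, w i * ((t - s) * ((1 - σ i) ^ 2 / ((s + σ i) * (t + σ i)))) = 0 := by
    have : ∑ i ∈ S, ((1 + s) * (w i * ((1 - σ i) / (s + σ i))) -
        (1 + t) * (w i * ((1 - σ i) / (t + σ i)))) = 0 := by
      rw [Finset.sum_sub_distrib, ← Finset.mul_sum, ← Finset.mul_sum, heq, sub_self]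
    rw [← this]
    refine Finset.sum_congr rfl fun i hi => ?_
    have h1 : 0 < s + σ i := by linarith [hσ i hi]
    have h2 : 0 < t + σ i := by linarith [hσ i hi]
    rw [← leaf_kernel_identity h1.ne' h2.ne']; ring
  intro i hi hwi
  have hzero := (Finset.sum_eq_zero_iff_of_nonneg hterm).1 hsum i hi
  have h1 : 0 < s + σ i := by linarith [hσ i hi]
  have h2 : 0 < t + σ i := by linarith [hσ i hi]
  have hts : 0 < t - s := by linarith
  rcases mul_eq_zero.1 hzero with h | h
  · exact absurd h hwi.ne'
  · rcases mul_eq_zero.1 h with h | h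
    · exact absurd h hts.ne'
    · rw [div_eq_zero_iff] at h
      rcases h with h | h
      · have : 1 - σ i = 0 := by simpa using h
        linarith
      · exact absurd h (mul_pos h1 h2).ne'

end Summit.CriticalPhenomena.Ising3DConformalLimit.Theorems.HRP2Rigidity.Negative
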